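import Summits.BirchSwinnertonDyer.BirchSwinnertonDyer.Theorems.EisensteinPrimesBSDpOnCellCTelescopeBranchZeroFibreOfFrobCharpoly
import Literature.NumberTheory.EllipticCurves.HasseWeilAbelian
import Literature.NumberTheory.EllipticCurves.TateModuleIrreducibleFrobenius
import Literature.AlgebraicGeometry.Motives.FaltingsECEndOfCoreProofs
import Literature.NumberTheory.EllipticCurves.ComplexMultiplicationNotSemistable
import Literature.RepresentationTheory.Semisimple.SubrepresentationEquiv
import Literature.NumberTheory.EllipticCurves.IsogenyFrobeniusTraceProofs
import Literature.NumberTheory.EllipticCurves.GoodReductionUnramifiedProofs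
import Literature.NumberTheory.EllipticCurves.NonvanishingTwistsWaldspurgerOfHoffsteinLuo
import Mathlib.RingTheory.TensorProduct.Free
import HarnessLib

/-!
# Eisenstein primes, Cell C telescope — the `ℚ_p`-base change of the framed integral Tate module

Helper for crux 4 `EisensteinPrimes.BSDpOnCellC` (line «telescope», de-assembly step T-An-2ᶠ → T-An-2ᴴ, zero fibre):
for a `ℤ_p`-basis `b` of `T_pE`, the `ℚ_p`-base change of the framed representation `[T_pE(·)]_b` IS the frame of
`V_pE = ℚ_p ⊗ T_pE` in the tensor basis `1 ⊗ b = Algebra.TensorProduct.basis ℚ_[p] b` (`baseChange_tateFrame_eq_frame_rational`, from Mathlib's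
`LinearMap.toMatrix_baseChange` and the tree's definition of `rationalGaloisRepTate` as the base change of `galoisRepTate`);
hence it is irreducible whenever `E` has no CM (`isIrreducible_baseChange_tateFrame`, transporting the tree's
`isIrreducible_rationalGaloisRepTate_of_finrank_ne_one` + `finrank_ne_one_of_stable_of_not_hasRationalCM_of_numberField`
along `ContinuousRep.frameEquiv`), in particular on Cell C where `E` has multiplicative reduction at `p`
(`isIrreducible_baseChange_tateFrame_of_hasMultiplicativeReductionAtPrime`). This is the input that lets the recognition
theorem `FramedGaloisRep.nonempty_equiv_of_hasFrobCharpolyAt_of_finite_of_isIrreducible` convert the Frobenius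
characteristic-polynomial clause (F-fib₀) of T-An-2ᶠ into the conjugacy clause (U-fib₀) of T-An-2ᴴ with NO semisimplicity
hypothesis on the lattice side; the companion input `isUnramifiedAt_and_hasFrobCharpolyAt_tateFrame` records, off `N_E ∋ p`, that the
framed integral Tate module is unramified with arithmetic-Frobenius characteristic polynomial `X² − a_ℓ(E) X + ℓ ∈ ℤ_p[X]`
(all tree theorems: good reduction off the conductor, Néron–Ogg–Shafarevich (easy direction), the discharged trace/determinant
facts of `HasseWeilGoodReductionProofs`, `a_v = a_ℓ` for the globally minimal equation, `#k_v = ℓ`). No statement of the route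
is proved here.
-/

noncomputable section

open scoped TensorProduct

open NumberField IsDedekindDomain Field
  Literature.NumberTheory.GaloisRepresentations
  Literature.NumberTheory.EllipticCurves
  Literature.RepresentationTheory.Semisimple

namespace Summit.BirchSwinnertonDyer.BirchSwinnertonDyer.Theorems.TelescopeBranchTateFrameRational

variable {p : ℕ} [Fact p.Prime] (W : WeierstrassCurve ℚ)

/-- **Matrix identity**: `[V_pE(σ)]_{1⊗b} = [T_pE(σ)]_b` read in `ℚ_p` (Mathlib `LinearMap.toMatrix_baseChange`; the tree defines
`rationalGaloisRepTate σ` as the base change of `galoisRepTate σ`). [folklore] -/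
theorem toMatrix_tensorBasis_rationalGaloisRepTate (b : Module.Basis (Fin 2) ℤ_[p] (W.tateModule p))
    (σ : absoluteGaloisGroup ℚ) :
    LinearMap.toMatrix (Algebra.TensorProduct.basis ℚ_[p] b : Module.Basis (Fin 2) ℚ_[p] (W.rationalTateModule p))
        (Algebra.TensorProduct.basis ℚ_[p] b : Module.Basis (Fin 2) ℚ_[p] (W.rationalTateModule p)) (W.rationalGaloisRepTate p σ) =
      (LinearMap.toMatrix b b (W.galoisRepTate p σ)).map (algebraMap ℤ_[p] ℚ_[p]) :=
  LinearMap.toMatrix_baseChange ℚ_[p] (W.galoisRepTate p σ) b b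

/-- **The `ℚ_p`-base change of the framed integral Tate module equals the frame of `V_pE` in the basis `1 ⊗ b`.** [folklore] -/
theorem baseChange_tateFrame_eq_frame_rational [W.IsElliptic] [Module.Finite ℤ_[p] (W.tateModule p)] [IsModuleTopology ℤ_[p] (W.tateModule p)]
    (b : Module.Basis (Fin 2) ℤ_[p] (W.tateModule p)) :
    FramedRep.baseChange (PadicInt.Coe.ringHom (p := p)) continuous_subtype_val
        ((WeierstrassCurve.tateGaloisRep W p (W.continuous_galoisRepTate_holds p)).frame b) =
      (rationalTateGaloisRepOf (WeierstrassCurve.geomPoints W) p (W.continuous_rationalGaloisRepTate_holds p)).frame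
        (Algebra.TensorProduct.basis ℚ_[p] b : Module.Basis (Fin 2) ℚ_[p] (W.rationalTateModule p)) := by
  refine ContinuousMonoidHom.ext fun σ => Units.ext ?_
  rw [FramedRep.baseChange_apply, ContinuousRep.coe_frame_apply]
  change ((LinearMap.toMatrix b b (W.galoisRepTate p σ)).map (PadicInt.Coe.ringHom (p := p))) =
    LinearMap.toMatrix (Algebra.TensorProduct.basis ℚ_[p] b : Module.Basis (Fin 2) ℚ_[p] (W.rationalTateModule p))
      (Algebra.TensorProduct.basis ℚ_[p] b : Module.Basis (Fin 2) ℚ_[p] (W.rationalTateModule p)) (W.rationalGaloisRepTate p σ)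
  rw [toMatrix_tensorBasis_rationalGaloisRepTate]
  rfl

/-- **Irreducibility of the base-changed Tate frame for a non-CM curve** (Serre 1968 IV.2.1 via the tree: no stable line for
`End_K(E) = ℤ`, `isIrreducible_rationalGaloisRepTate_of_finrank_ne_one`). [folklore] -/
theorem isIrreducible_baseChange_tateFrame [W.IsElliptic] [Module.Finite ℤ_[p] (W.tateModule p)] [IsModuleTopology ℤ_[p] (W.tateModule p)]
    (hCM : ¬ W.HasCM) (b : Module.Basis (Fin 2) ℤ_[p] (W.tateModule p)) :
    (FramedRep.baseChange (PadicInt.Coe.ringHom (p := p)) continuous_subtype_val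
        ((WeierstrassCurve.tateGaloisRep W p (W.continuous_galoisRepTate_holds p)).frame b)).IsIrreducible := by
  rw [baseChange_tateFrame_eq_frame_rational]
  have hRCM : ¬ W.HasRationalCM := fun h => hCM h.hasCM
  have hp : ((p : ℕ) : ℚ) ≠ 0 := by exact_mod_cast (Fact.out : p.Prime).ne_zero
  have hirr : (W.rationalGaloisRepTate p).IsIrreducible :=
    WeierstrassCurve.isIrreducible_rationalGaloisRepTate_of_finrank_ne_one W p hp
      (fun L hL => Literature.AlgebraicGeometry.Motives.finrank_ne_one_of_stable_of_not_hasRationalCM_of_numberField W p hRCM L hL)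
  haveI : (rationalTateGaloisRepOf (WeierstrassCurve.geomPoints W) p
      (W.continuous_rationalGaloisRepTate_holds p)).toRepresentation.IsIrreducible := hirr
  exact Representation.isIrreducible_of_equiv
    ((rationalTateGaloisRepOf (WeierstrassCurve.geomPoints W) p (W.continuous_rationalGaloisRepTate_holds p)).frameEquiv
      (Algebra.TensorProduct.basis ℚ_[p] b : Module.Basis (Fin 2) ℚ_[p] (W.rationalTateModule p))).toRepEquiv.symm

/-- The same for a curve with multiplicative reduction at `p` (Cell C: `p ∥ N`), which has no CM. [folklore] -/
theorem isIrreducible_baseChange_tateFrame_of_hasMultiplicativeReductionAtPrime [W.IsElliptic]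
    [Module.Finite ℤ_[p] (W.tateModule p)] [IsModuleTopology ℤ_[p] (W.tateModule p)]
    (hmult : W.HasMultiplicativeReductionAtPrime p) (b : Module.Basis (Fin 2) ℤ_[p] (W.tateModule p)) :
    (FramedRep.baseChange (PadicInt.Coe.ringHom (p := p)) continuous_subtype_val
        ((WeierstrassCurve.tateGaloisRep W p (W.continuous_galoisRepTate_holds p)).frame b)).IsIrreducible :=
  isIrreducible_baseChange_tateFrame W
    (fun hCM => WeierstrassCurve.not_hasMultiplicativeReductionAtPrime_of_hasCM W hCM p hmult) b

/-- The irreducibility above in the `ContinuousRep.IsIrreducible` spelling of `FramedGaloisRep.toGaloisRep` (the form consumed by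
`FramedGaloisRep.nonempty_equiv_of_hasFrobCharpolyAt_of_finite_of_isIrreducible`). [folklore] -/
theorem isIrreducible_toGaloisRep_baseChange_tateFrame [W.IsElliptic]
    [Module.Finite ℤ_[p] (W.tateModule p)] [IsModuleTopology ℤ_[p] (W.tateModule p)]
    (hCM : ¬ W.HasCM) (b : Module.Basis (Fin 2) ℤ_[p] (W.tateModule p)) :
    (FramedGaloisRep.toGaloisRep (FramedRep.baseChange (PadicInt.Coe.ringHom (p := p)) continuous_subtype_val
      ((WeierstrassCurve.tateGaloisRep W p (W.continuous_galoisRepTate_holds p)).frame b))).IsIrreducible :=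
  isIrreducible_baseChange_tateFrame W hCM b

/-- … and on Cell C (multiplicative reduction at `p`). [folklore] -/
theorem isIrreducible_toGaloisRep_baseChange_tateFrame_of_hasMultiplicativeReductionAtPrime [W.IsElliptic]
    [Module.Finite ℤ_[p] (W.tateModule p)] [IsModuleTopology ℤ_[p] (W.tateModule p)]
    (hmult : W.HasMultiplicativeReductionAtPrime p) (b : Module.Basis (Fin 2) ℤ_[p] (W.tateModule p)) :
    (FramedGaloisRep.toGaloisRep (FramedRep.baseChange (PadicInt.Coe.ringHom (p := p)) continuous_subtype_val
      ((WeierstrassCurve.tateGaloisRep W p (W.continuous_galoisRepTate_holds p)).frame b))).IsIrreducible :=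
  isIrreducible_baseChange_tateFrame_of_hasMultiplicativeReductionAtPrime W hmult b

/-- If `p ∣ N_E` then a place `v` with `ℓ_v ∤ N_E` does not lie over `p`. [folklore] -/
theorem natCast_not_mem_asIdeal_of_not_dvd_conductorNorm [W.IsElliptic] (hpN : p ∣ W.conductorNorm ℤ)
    (v : HeightOneSpectrum (𝓞 ℚ)) (hv : ¬ ((Rat.HeightOneSpectrum.primesEquiv v : Nat.Primes) : ℕ) ∣ W.conductorNorm ℤ) :
    ((p : ℕ) : 𝓞 ℚ) ∉ v.asIdeal := by
  intro hmem
  have h1 : Rat.HeightOneSpectrum.natGenerator v ∣ p := by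
    rw [Rat.HeightOneSpectrum.natGenerator_dvd_iff, Ideal.mem_map_of_equiv]
    exact ⟨p, hmem, map_natCast _ p⟩
  have h2 : (Rat.HeightOneSpectrum.primesEquiv v : ℕ) = p :=
    (Nat.prime_dvd_prime_iff_eq (Rat.HeightOneSpectrum.prime_natGenerator v) (Fact.out : p.Prime)).mp h1
  rw [h2] at hv
  exact hv hpN

/-- **The framed integral Tate module off `N_E ∋ p`: unramified, with arithmetic-Frobenius characteristic polynomial
`X² − a_ℓ(E) X + ℓ ∈ ℤ_p[X]`** (`a_ℓ(E) = W.frobeniusTrace ℓ` of the globally minimal equation). All tree theorems: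
good reduction off the conductor (`hasGoodReductionAt_of_not_dvd_conductorNorm`), Néron–Ogg–Shafarevich easy direction
(`isUnramifiedAt_tateGaloisRep'`), `charpoly_galoisRepTate_of_hasGoodReductionAt` with the discharged trace / determinant facts
(`trace_/det_galoisRepTate_frobenius_of_hasGoodReductionAt_holds`), `frobeniusTraceAt_eq_frobeniusTrace`,
`natCard_residueField_adicCompletionIntegers`, read in the frame (`GaloisRep.isUnramifiedAt_frame_iff`,
`hasFrobCharpolyAt_tateFrame_iff`). [cite: SilvermanAEC2009, Prop. VII.4.1(b), C.21 Remark 21.3] -/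
theorem isUnramifiedAt_and_hasFrobCharpolyAt_tateFrame [W.IsElliptic] [W.IsGloballyMinimal]
    [Module.Finite ℤ_[p] (W.tateModule p)] [IsModuleTopology ℤ_[p] (W.tateModule p)]
    (hpN : p ∣ W.conductorNorm ℤ) (b : Module.Basis (Fin 2) ℤ_[p] (W.tateModule p))
    (v : HeightOneSpectrum (𝓞 ℚ)) (hv : ¬ ((Rat.HeightOneSpectrum.primesEquiv v : Nat.Primes) : ℕ) ∣ W.conductorNorm ℤ) :
    FramedGaloisRep.IsUnramifiedAt v ((WeierstrassCurve.tateGaloisRep W p (W.continuous_galoisRepTate_holds p)).frame b) ∧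
    FramedGaloisRep.HasFrobCharpolyAt v
      (Polynomial.X ^ 2
        - Polynomial.C (((W.frobeniusTrace ((Rat.HeightOneSpectrum.primesEquiv v : Nat.Primes) : ℕ) : ℤ) : ℤ_[p])) * Polynomial.X
        + Polynomial.C ((((Rat.HeightOneSpectrum.primesEquiv v : Nat.Primes) : ℕ) : ℤ_[p])))
      ((WeierstrassCurve.tateGaloisRep W p (W.continuous_galoisRepTate_holds p)).frame b) := by
  haveI := WeierstrassCurve.module_free_tateModule_holds W p
  have hgood : W.HasGoodReductionAt v := hasGoodReductionAt_of_not_dvd_conductorNorm W v hv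
  have hℓp : ((p : ℕ) : 𝓞 ℚ) ∉ v.asIdeal := natCast_not_mem_asIdeal_of_not_dvd_conductorNorm W hpN v hv
  refine ⟨(GaloisRep.isUnramifiedAt_frame_iff v _ b).2 (W.isUnramifiedAt_tateGaloisRep' p hgood hℓp), ?_⟩
  refine (TelescopeBranchZeroFibreOfFrobCharpoly.hasFrobCharpolyAt_tateFrame_iff W b v _).2 ?_
  intro 𝔓 h𝔓 σ hσ
  change (W.galoisRepTate p σ).charpoly = _
  rw [W.charpoly_galoisRepTate_of_hasGoodReductionAt (W.trace_galoisRepTate_frobenius_of_hasGoodReductionAt_holds p)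
      (W.det_galoisRepTate_frobenius_of_hasGoodReductionAt_holds p) hℓp hgood h𝔓 hσ,
    W.frobeniusTraceAt_eq_frobeniusTrace v, WeierstrassCurve.natCard_residueField_adicCompletionIntegers v]

end Summit.BirchSwinnertonDyer.BirchSwinnertonDyer.Theorems.TelescopeBranchTateFrameRational

end
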